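import Literature.Barriers.CriticalPhenomena.RigorousRGSmallParameterWick
import HarnessLib

/-!
# `RigorousRGSmallParameter` (Slade, Theorem 1.4.1): first-order perturbation theory —
# `E_Cθ V_x = gτ_x² + (ν + (n+2)gC_{xx})τ_x + (u + ½nνC_{xx} + ¼n(n+2)gC_{xx}²)` exactly

Companion ("proof architecture") file of
`Literature/Barriers/CriticalPhenomena/RigorousRGSmallParameter.lean`. Combining Wick's theorem
(`…Wick.thetaConv_eq_expL`: `E_Cθ = e^{ℒ_C}` on polynomials) with the explicit heat flow of the
local polynomial (`…PerturbativeRange.expL_localPoly`) gives the exact Gaussian expectation of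
Slade's interaction `V_x = gτ_x² + ντ_x + u` (`τ_x = ½|φ_x|²`) shifted by the field:
`∫ V_x(φ + ζ) dP_C(ζ) = gτ_x² + (ν + (n+2)gC_{xx})τ_x + (u + ½nνC_{xx} + ¼n(n+2)gC_{xx}²)` — the
first-order terms `η'g_j = (n+2)C_{j+1;0,0}g_j` of `ν_pt` in Proposition 5.1.1 / display (5.5) of
[Slade2017], and the term `e^{ℒ}V` of `φ_pt(V) = e^{ℒ}V - P` (display (4.13)).

Sources: G. Slade, arXiv:1611.06169, §4.3 (display (4.13)), §5.1 (displays (5.3)–(5.6),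
`η' = (n+2)C_{j+1;0,0}`); [BS-rg-norm] arXiv:1403.7244 §2.

## What this file provides (theorems; no named fact)

* **`thetaConv_localPoly`** — the displayed identity, for every positive semidefinite `C`.
* `thetaConv_tau` — `E_Cθ τ_x = τ_x + ½nC_{xx}`.

## References

* [Slade2017] G. Slade, *Critical exponents for long-range O(n) models below the upper critical
  dimension*, Commun. Math. Phys. 358 (2018) 343–436, arXiv:1611.06169 — §4.3, §5.1.
* [BrydgesSlade2015RGI] D. C. Brydges, G. Slade, *A renormalisation group method. I.*,
  J. Stat. Phys. 159 (2015) 421–460, arXiv:1403.7244 — §2.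
-/

noncomputable section

namespace Literature.Barriers.CriticalPhenomena

namespace LongRangePhi4

namespace Wick

open MeasureTheory Finset Tphi RGNorm LocalPoly Loc PTFun GaussIBP Literature.Probability.LatticeModels
open scoped ContDiff

variable {d M n : ℕ} [NeZero M]

/-- **First-order perturbation theory, exactly**: for positive semidefinite `C`,
`E_Cθ(gτ_x² + ντ_x + u) = gτ_x² + (ν + (n+2)gC_{xx})τ_x + (u + ½nνC_{xx} + ¼n(n+2)gC_{xx}²)`.
[cite: Slade2017, §5.1 (display (5.5), η' = (n+2)C_{j+1;0,0}) and §4.3 (display (4.13))] -/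
theorem thetaConv_localPoly {C : Matrix (TorusSite d M) (TorusSite d M) ℝ} (hC : C.PosSemidef) (g ν u : ℝ) (x : TorusSite d M) :
    thetaConv (fieldGaussian (TorusSite d M) C n) (localPoly (n := n) g ν u x) =
      localPoly g (ν + ((n : ℝ) + 2) * g * C x x)
        (u + 2⁻¹ * (n : ℝ) * ν * C x x + 4⁻¹ * ((n : ℝ) + 2) * (n : ℝ) * g * C x x ^ 2) x := by
  rw [thetaConv_eq_expL hC (contDiff_localPoly g ν u x) (A := 4) (A' := 2)
      (fun φ z hz => coeff_localPoly_eq_zero g ν u x z hz φ) le_rfl,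
    expL_localPoly C le_rfl 2⁻¹ g ν u x]
  congr 1 <;> ring

/-- **`E_Cθ τ_x = τ_x + ½nC_{xx}`.** [cite: Slade2017, §5.1] -/
theorem thetaConv_tau {C : Matrix (TorusSite d M) (TorusSite d M) ℝ} (hC : C.PosSemidef) (x : TorusSite d M) :
    thetaConv (fieldGaussian (TorusSite d M) C n) (tau (n := n) x) = fun φ => tau x φ + 2⁻¹ * (n : ℝ) * C x x := by
  have h := thetaConv_localPoly (n := n) hC 0 1 0 x
  have h0 : localPoly (d := d) (M := M) (n := n) 0 1 0 x = tau x := by funext φ; simp [localPoly]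
  rw [h0] at h
  rw [h]
  funext φ
  simp [localPoly]

end Wick

end LongRangePhi4

end Literature.Barriers.CriticalPhenomena

end
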